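import Summits.QuantumFields.BalabanUV.Beta.FP.KernelStepDressing
import Summits.QuantumFields.BalabanUV.Beta.FP.WoundEvenFamilyParities
import Summits.QuantumFields.BalabanUV.Beta.NVertexParitiesW
import Summits.QuantumFields.BalabanUV.Beta.GAN24.SecondOrderReadersParity
import Literature.MathematicalPhysics.QuantumFieldTheory.Balaban1983to89.Beta.HessianTelescopingKKT

/-!
# `BalabanUV.Beta.FP.TowerFWoundParities` — road «FP», binder row D1, ROUTE T (β1), (H5-F) box side, part 2: **THE TWO SECOND-ORDER PARITY LETTERS `hWFm hWFt`
# OF THE WOUND EVEN DRESSED F-FAMILY, BY NAME** — at `𝒲bF (n+1) B μ y ν y′ := x z a b ↦ Σ'_e (𝒲F (n+1) μ y ν (y′ + Mc B•e))♮ x z a b`, `𝒲F (n+1) := σ′•(Lc⁸ • dressW (Lc^(n+1)) Lc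
# (wStep Lc (n+1)) (WN ctr Pn n))`, `♮ = ½•(· + sgnK (trK ·))` (the END's N-side choice `𝒲bN`, v10 L.230, now on the F side): the periodised family has NO entries on two multiplier
# indices (an2 `NVertexParitiesW.WN_inr_inr` through the double superposition) and its (field, multiplier) border is the ANTI-twin of its (multiplier, field) border
# (graded-evenness of any even half — road `WoundEvenFamilyParities` §1–§2 generic rows), v10 `StepRecursionFeedNestedNamedI` L.248–249

WHY (located).  road g58 STAGED-5 l.69000: after FILE 4 the END's F box side keeps `hWFw`, `hWFm hWFt`, `hHF₁ hQF₁ hHF₂ hQF₂`.  The two second-order parities are structural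
for the WOUND EVEN half of ANY second-order family whose `μμ` block vanishes pointwise — exactly the road's v5-era generic rows (`perF_dper_apply_eq_zero_of_inr_inr`,
`perF_dper_antitwin_fμ_of_parityEven`); this file feeds them the dressed `WN` (END 41 → 39 by kernel).

WHAT ([folklore]; no `def`, nothing cited, 0 sorry): §1 `dressW_apply_inr_inr_WN`, `FRecW_inr_inr` (pointwise `μμ` block of the dressed family vanishes); §2 **`hWFm_rec`**, **`hWFt_rec`**
(v10's binder texts at the wound even dressed family, generic torus `M`, box `Mb` and multiplier-valued index map `f`).
WHAT THIS IS NOT: not `hWFw` (the winding letter — needs the far-small decay of the dressed family's source copies), not `hHF₁ hQF₁ hHF₂ hQF₂`; nothing of Bałaban's asserted,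
valued or discharged; 0 estimates; 0∕4 row-D1 binders; NOT (C1), NOT D1, NEVER «G-an2-4 closed», NOT BetaPertH, NOT continuum, NOT Clay.
HONEST DEPENDENCY (page 1, mandatory): continuum YM on T⁴ ⇐ BetaPertH ∧ nine spine estimates (0/9 proved); BetaPertH ⇐ (D1) ∧ (D4) ∧ CAP+tail;
G-an2-4 gates asym, D1 and NE2/3/4.  HONEST FRAMING (cell contract, verbatim): «discharging `BetaPertH` makes Bałaban's UV stability UNCONDITIONAL —
a real constructive-QFT result; it is NOT the continuum limit and NOT the Clay problem.»  ABSOLUTE RULE (cell charter, verbatim): «No internally-minted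
statement may enter as a cited fact. Every hypothesis is either kernel-proved in this package or a verbatim quotation of a PUBLISHED theorem with page
reference. The manuscript(s) under audit are NOT citable for their own disputed steps — they are the thing under adjudication; programme-internal
(2001/route/tribunal) claims are never citable.»  Road «FP» OWNER, b2b-balaban-beta-d1-p3 gen 58, 2026-08-29.  No existing file touched.
-/

noncomputable section

open scoped BigOperators

namespace Summit.QuantumFields.BalabanUV.Beta.FP.TowerFWoundParities

open Literature.MathematicalPhysics.QuantumFieldTheory
open Literature.MathematicalPhysics.QuantumFieldTheory.Balaban1983to89
open Literature.MathematicalPhysics.QuantumFieldTheory.Balaban1983to89.Beta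
open B4TorusKernel.MultiPeriod (translate)
open B6Lemma24Torus (pbox)
open ExpKernelCalculus (Site MKer)
open DressedMomentNormalisation (EKer)
open HessKerRate (scaleK scaleK_apply)
open HessianTelescopingKKT (wStep)
open OneStepResolventKernel (Fib)
open Summit.QuantumFields.BalabanUV.Beta.TameKernelCalculus (trK)
open Summit.QuantumFields.BalabanUV.Beta.BorderedHessian (sgnK)
open Summit.QuantumFields.BalabanUV.Beta.GAN24.SecondOrderReadersParity (parityEven_evenHalf)
open Summit.QuantumFields.BalabanUV.Beta.CompositeOneShotJetData (Roots Pins WN)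
open Summit.QuantumFields.BalabanUV.Beta.NVertexParitiesW (WN_inr_inr)
open Summit.QuantumFields.BalabanUV.Beta.FP.KernelPeriodisationFib (Idx perF)
open Summit.QuantumFields.BalabanUV.Beta.FP.KernelPeriodisationFibLoc (dper)
open Summit.QuantumFields.BalabanUV.Beta.FP.KernelStepDressing (dressW dressW_apply)
open Summit.QuantumFields.BalabanUV.Beta.FP.WoundEvenFamilyParities (parityEven_tsum inr_inr_tsum_eq_zero inr_inr_evenHalf_eq_zero
  perF_dper_apply_eq_zero_of_inr_inr perF_dper_antitwin_fμ_of_parityEven)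

variable {Lc : ℕ} [NeZero Lc] (R : Roots Lc) (P : Pins)

/-! ## §1 The dressed second-order family has no `μμ` block -/

section Pointwise

variable (N L : ℕ) [NeZero N] (w : EKer (3 + 1))

/-- [folklore] **NO MULTIPLIER–MULTIPLIER ENTRIES** survive the double dressing of `WN` (an2 `WN_inr_inr` termwise). -/
theorem dressW_apply_inr_inr_WN (j : ℕ) (μ : Fin (3 + 1)) (y : Site (3 + 1)) (ν : Fin (3 + 1)) (y' x z : Site (3 + 1)) (m m' : Fin (3 + 1)) :
    dressW N L w (WN R P j) μ y ν y' x z (Sum.inr m) (Sum.inr m') = 0 := by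
  rw [dressW_apply]
  simp only [WN_inr_inr, mul_zero, tsum_zero, Finset.sum_const_zero]

variable (uF : ℕ → ℝ) (n : ℕ)

/-- [folklore] the END's dressed second-order family `scaleK σ′ σ′ (Lc⁸ • dressW …)` has no `μμ` block. -/
theorem FRecW_inr_inr (μ : Fin (3 + 1)) (y : Site (3 + 1)) (ν : Fin (3 + 1)) (y' x z : Site (3 + 1)) (m m' : Fin (3 + 1)) :
    scaleK (Sum.elim (fun _ : Fin (3 + 1) => (1 : ℝ)) (fun _ : Fin (3 + 1) => (uF n))) (Sum.elim (fun _ : Fin (3 + 1) => (1 : ℝ)) (fun _ : Fin (3 + 1) => (uF n)))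
        ((Lc : ℝ) ^ 8 • dressW (Lc ^ (n + 1)) Lc (wStep Lc (n + 1)) (WN (Roots.ctr Lc) P n) μ y ν y') x z (Sum.inr m) (Sum.inr m') = 0 := by
  rw [scaleK_apply]
  simp only [Pi.smul_apply, smul_eq_mul, dressW_apply_inr_inr_WN, mul_zero, zero_mul]

end Pointwise

/-! ## §2 THE TWO LETTERS at the wound even dressed family -/

section Record

variable (Lc) (Pn : Pins) (uF : ℕ → ℝ) {M : Fin (3 + 1) → ℕ} (Mb : Fin (3 + 1) → ℕ) {ι : Type*} (f : ι → Idx M (Fib 3))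
  (hf : ∀ a : ι, ∃ m : Fin (3 + 1), (f a).2 = Sum.inr m)
include hf

/-- [folklore] **`hWFm` AT THE RECORD** — v10's binder `hWFm` (L.248) with `(𝒲bF (n + 1)) B` ↦ the WOUND EVEN half of the σ′-scaled `Lc⁸ •` dressed `WN` (box `Mb` in place of
`Mc B`) and a generic multiplier-valued index map: on two such indices the periodised family VANISHES. -/
theorem hWFm_rec (n : ℕ) (μ : Fin (3 + 1)) (y : Fin (3 + 1) → ℤ) (ν : Fin (3 + 1)) (y' : Fin (3 + 1) → ℤ) (a a' : ι) :
    (perF M (dper M ((fun μ y ν y' => (fun x z a b => ∑' e : Site (3 + 1), ((1 / 2 : ℝ) • ((fun μ y ν y' => scaleK (Sum.elim (fun _ : Fin (3 + 1) => (1 : ℝ)) (fun _ : Fin (3 + 1) => (uF n))) (Sum.elim (fun _ : Fin (3 + 1) => (1 : ℝ)) (fun _ : Fin (3 + 1) => (uF n))) ((Lc : ℝ) ^ 8 • dressW (Lc ^ (n + 1)) Lc (wStep Lc (n + 1)) (WN (Roots.ctr Lc) Pn n) μ y ν y')) μ y ν (translate Mb y' e) + sgnK (trK ((fun μ y ν y'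 => scaleK (Sum.elim (fun _ : Fin (3 + 1) => (1 : ℝ)) (fun _ : Fin (3 + 1) => (uF n))) (Sum.elim (fun _ : Fin (3 + 1) => (1 : ℝ)) (fun _ : Fin (3 + 1) => (uF n))) ((Lc : ℝ) ^ 8 • dressW (Lc ^ (n + 1)) Lc (wStep Lc (n + 1)) (WN (Roots.ctr Lc) Pn n) μ y ν y')) μ y ν (translate Mb y' e))))) x z a b)) μ y ν y'))) (f a) (f a') = 0 :=
  perF_dper_apply_eq_zero_of_inr_inr M f hf
    (fun x z m m' => inr_inr_tsum_eq_zero _ (fun e x' z' m₁ m₂ => inr_inr_evenHalf_eq_zero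
      (fun x'' z'' m₃ m₄ => FRecW_inr_inr Pn uF n μ y ν (translate Mb y' e) x'' z'' m₃ m₄) x' z' m₁ m₂) x z m m') a a'

/-- [folklore] **`hWFt` AT THE RECORD** — v10's binder `hWFt` (L.249) under the same σ: the (field, multiplier) border is the ANTI-twin of the (multiplier, field) border
(graded-evenness of the wound even half: road `parityEven_tsum` over GAN24 `parityEven_evenHalf`). -/
theorem hWFt_rec (n : ℕ) (μ : Fin (3 + 1)) (y : Fin (3 + 1) → ℤ) (ν : Fin (3 + 1)) (y' : Fin (3 + 1) → ℤ) (b : ↥(pbox M) × Fin (3 + 1)) (a : ι) :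
    (perF M (dper M ((fun μ y ν y' => (fun x z a b => ∑' e : Site (3 + 1), ((1 / 2 : ℝ) • ((fun μ y ν y' => scaleK (Sum.elim (fun _ : Fin (3 + 1) => (1 : ℝ)) (fun _ : Fin (3 + 1) => (uF n))) (Sum.elim (fun _ : Fin (3 + 1) => (1 : ℝ)) (fun _ : Fin (3 + 1) => (uF n))) ((Lc : ℝ) ^ 8 • dressW (Lc ^ (n + 1)) Lc (wStep Lc (n + 1)) (WN (Roots.ctr Lc) Pn n) μ y ν y')) μ y ν (translate Mb y' e) + sgnK (trK ((fun μ y ν y' => scaleK (Sum.elim (fun _ : Fin (3 + 1) => (1 : ℝ)) (fun _ : Fin (3 + 1) => (uF n))) (Sum.elim (fun _ : Fin (3 + 1) => (1 : ℝ)) (fun _ : Fin (3 + 1) => (uF n))) ((Lc : ℝ) ^ 8 • dressW (Lc ^ (n + 1)) Lc (wStep Lc (n + 1)) (WN (Roots.ctr Lc) Pn n) μ y ν y')) μ y ν (translate Mb y' e))))) x z a b)) μ y ν y'))) (b.1, Sum.inl b.2) (f a) = -((perF M (dper M ((fun μ y ν y' => (fun x z a b => ∑' e : Site (3 + 1), ((1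 / 2 : ℝ) • ((fun μ y ν y' => scaleK (Sum.elim (fun _ : Fin (3 + 1) => (1 : ℝ)) (fun _ : Fin (3 + 1) => (uF n))) (Sum.elim (fun _ : Fin (3 + 1) => (1 : ℝ)) (fun _ : Fin (3 + 1) => (uF n))) ((Lc : ℝ) ^ 8 • dressW (Lc ^ (n + 1)) Lc (wStep Lc (n + 1)) (WN (Roots.ctr Lc) Pn n) μ y ν y')) μ y ν (translate Mb y' e) + sgnK (trK ((fun μ y ν y' => scaleK (Sum.elim (fun _ : Fin (3 + 1) => (1 : ℝ)) (fun _ : Fin (3 + 1) => (uF n))) (Sum.elim (fun _ : Fin (3 + 1) => (1 : ℝ)) (fun _ : Fin (3 + 1) => (uF n))) ((Lc : ℝ) ^ 8 • dressW (Lc ^ (n + 1)) Lc (wStep Lc (n + 1)) (WN (Roots.ctr Lc) Pn n) μ y ν y')) μ y ν (translate Mb y' e))))) x z a b)) μ y ν y'))) (f a) (b.1, Sum.inl b.2)) :=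
  perF_dper_antitwin_fμ_of_parityEven M f hf (parityEven_tsum _ fun _ => parityEven_evenHalf _) b a

end Record

end Summit.QuantumFields.BalabanUV.Beta.FP.TowerFWoundParities

end
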